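import Summits.AtomisticToContinuum.Crystallization.Theorems.OverbindingBudgetAffineFarFieldCollarWindow

/-!
# Overbinding budget, affine far field — «CollarNear»: the window facts of the interface row from per-site ROWS

Support file for `Summit.AtomisticToContinuum.Crystallization.Theses.OverbindingBudget.RobustDefectLimitWindows`
(sub-problem (2c), leaf SW♭(30), part 27V «Voronoi-cell quadrature of the far field», interface row, design (R*)
«reference frontier»).  «CollarWindow» ★ `interfaceRow_window` takes five WINDOW FACTS in actual-position form —
(W-band) `hband` / `hnear` with per-site widths `w u`, (W-core) `hcore` / `hunc`, (W-far) `hfar`.  This file EXPORTS them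
from the data a K-file (census 27V-I, hand-2) actually holds per reference site `u` of the band
`r_c − m < dist (placedSite u) q₀ < r_c + M`, all in WORLD coordinates against THE reference tessellation
(`placedSite s ν q R`, «CollarSites»), so that no pattern isometry has to be named by the atlas:

* (R-reg)   every charted atom is `û`-registered: `dist (ych u) (placedSite u) ≤ û` (`u ∈ Ach`);
* (R-pos)   band sites are charted with a per-site position row `dist (ych u) (placedSite u) ≤ ûs u` (F2 position clause);
* (R-chart) a per-site chart `A u : E3 ≃L[ℝ] E3` near the identity, `‖A u x − x‖ ≤ θ u·‖x‖` (F2 matrix clause: misfit +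
            misorientation of the local lattice against the reference frame), conformal up to `mc` at a free local
            dilation `lam u` (CellVoronoi's `hB`), `‖A u‖ ≤ a`;
* (R-star)  the STAR FIT: each of the twelve reference neighbours `u'` (`barlowSiteForm s u u' = 12`) is charted and its atom
            sits within `δ₀` of the chart's prediction `ych u + A u (placedSite u' − placedSite u)`;
* (R-num)   the outer sandwich inequality of «CellVoronoi» at slack `σ`:
            `(1+σ)·mc·λ²ν²/2 + a·δ₀·((1+σ)r₀ + ν) + δ₀²/2 < σ(1−mc)·λ²ν²/2`, `r₀ = ν/√2`.

THE CHAIN (§2 `near_of_star`).  «CellLattice» `voronoiCell_placed_barlowStacking` produces the tangent-arrangement isometry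
`A₀` of the site (reference cell `= placedSite u + R(A₀(idealCell b ν))`, kissing shell `= 2·A₀(pattern b)`); with the
reference frame `G := A₀ ≫ R` the star fit is exactly «CellVoronoi»'s `hnear` for the pattern-frame chart `A u ∘ G`, so
`voronoiCell_subset_image_shellCell` gives the SANDWICH OUT `cell ⊆ ych u + A u(G((1+σ)·idealCell b ν))` (§1, with
«CellShell» `shellCell_pattern`), and «CollarBand» `nearness_of_rows` turns (R-pos) + (R-chart) + sandwich into the
pointwise nearness `∀ x ∈ cell, ∃ x' ∈ refCell u, dist x x' ≤ ûs u + (θ u(1+σ) + σ)·r₀` — the half-width `w(L)` of the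
F3 price memo (F3-g97 §2: `û(L) = c·L(L−1)/2 + L·η`, `θ(L) = θ₀ + L·c`, σ = 2.3525e-3, book `w ≤ 0.04ν`, threshold `0.146ν`;
docstring numbers, not load-bearing).  §3 ★ `interfaceRow_rows` = `interfaceRow_window` with the five window facts
replaced by the rows: `hband` from (R-pos)+(R-reg), `hnear` from §2 (any booked width `w u ≥ ûs u + (θ u(1+σ) + σ)r₀`),
`hcore` / `hfar` from (R-reg) by the triangle inequality with `m' := m − û`, `M' := M − û` (margins `2r₀ + 2û < m`,
`3r₀ + 2û < M`), `hunc` kept (uncharted atoms within `r_c − m + û`; vacuous for a far-field mover window).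

[this file; Conway–Sloane, Sphere Packings ch. 2, 21]
-/

namespace Summit.AtomisticToContinuum.Crystallization.Theorems.OverbindingBudgetAffineFarFieldCollarNear

noncomputable section

open Set MeasureTheory Metric
open scoped Pointwise
open Literature.Geometry.DiscreteGeometry Literature.MathematicalPhysics.StatisticalMechanics
open Literature.Barriers.AtomisticToContinuum (voronoiCell)
open Summit.AtomisticToContinuum.Crystallization.Theorems.OverbindingBudgetAffineFarFieldCellAffine
open Summit.AtomisticToContinuum.Crystallization.Theorems.OverbindingBudgetAffineFarFieldCellVoronoi
open Summit.AtomisticToContinuum.Crystallization.Theorems.OverbindingBudgetAffineFarFieldCellLedgerIdeal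
open Summit.AtomisticToContinuum.Crystallization.Theorems.OverbindingBudgetAffineFarFieldCellShell
open Summit.AtomisticToContinuum.Crystallization.Theorems.OverbindingBudgetAffineFarFieldCellLattice
open Summit.AtomisticToContinuum.Crystallization.Theorems.OverbindingBudgetAffineFarFieldCollarBand
open Summit.AtomisticToContinuum.Crystallization.Theorems.OverbindingBudgetAffineFarFieldCollarSites
open Summit.AtomisticToContinuum.Crystallization.Theorems.OverbindingBudgetAffineFarFieldCollarWindow

local notation "E3" => EuclideanSpace ℝ (Fin 3)
local notation "Idx" => ℤ × ℤ × ℤ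

/-! ## §1 Sandwich OUT from the star fit, chart in world coordinates -/

/-- support: the kissing pattern of letter `b` (`true`: fcc, `false`: hcp) is a unit pattern. [Literature KissingPatterns] -/
theorem norm_eq_one_of_mem_letterPattern (b : Bool) : ∀ x ∈ (bif b then fccKissingPattern else hcpKissingPattern), ‖x‖ = 1 := by
  cases b
  · exact fun _ hx => norm_eq_one_of_mem_hcpKissingPattern hx
  · exact fun _ hx => norm_eq_one_of_mem_fccKissingPattern hx

/-- support: the kissing pattern of letter `b` is nonempty. [«CellShell»] -/
theorem nonempty_letterPattern (b : Bool) : Nonempty ↥(bif b then fccKissingPattern else hcpKissingPattern) := by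
  cases b
  · exact nonempty_hcpKissingPattern
  · exact nonempty_fccKissingPattern

/-- support (SANDWICH OUT FROM THE STAR FIT): «CellVoronoi» `voronoiCell_subset_image_shellCell` for a chart given in WORLD
coordinates. `P` a unit pattern with shell cell of circumradius `r` (`r² ≤ ν²/2`) at scale `ν`, `G` a linear isometry
(the reference frame: pattern → world), `A : E3 ≃L[ℝ] E3` the world chart (conformal up to `m` at dilation `λ`, `‖A‖ ≤ a`);
if every star point `y + A(ν·G p)`, `p ∈ P`, has an atom of `Z` within `δ₀` and the outer inequality holds at slack `σ`, then
`voronoiCell Z y ⊆ y + A(G(shellCell (patternStar P ν) (1+σ)))`. [this file] -/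
theorem voronoiCell_subset_image_of_star {P : Finset E3} (hP : ∀ x ∈ P, ‖x‖ = 1) [Nonempty ↥P] {ν r : ℝ}
    (hν : 0 < ν) (hr : r ^ 2 ≤ ν ^ 2 / 2) (hPc : shellCell (patternStar P ν) 1 ⊆ closedBall 0 r) (G : E3 ≃ₗᵢ[ℝ] E3)
    (A : E3 ≃L[ℝ] E3) {y : E3} {Z : Set E3} {lam m a δ₀ σ : ℝ} (hm0 : 0 ≤ m)
    (hB : ∀ x x' : E3, |inner ℝ (A x) (A x') - lam ^ 2 * inner ℝ x x'| ≤ m * lam ^ 2 * ‖x‖ * ‖x'‖)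
    (ha : ‖(A : E3 →L[ℝ] E3)‖ ≤ a) (hσ : 0 ≤ σ) (hstar : ∀ p ∈ P, ∃ z ∈ Z, ‖z - (y + A (ν • G p))‖ ≤ δ₀)
    (hout : (1 + σ) * m * lam ^ 2 * ν ^ 2 / 2 + a * δ₀ * ((1 + σ) * r + ν) + δ₀ ^ 2 / 2 <
      σ * (1 - m) * lam ^ 2 * ν ^ 2 / 2) :
    voronoiCell Z y ⊆ (fun k => y + A (G k)) '' shellCell (patternStar P ν) (1 + σ) := by
  -- the chart in the pattern frame
  set A' : E3 ≃L[ℝ] E3 := G.toContinuousLinearEquiv.trans A with hA'def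
  have hA' : ∀ k, A' k = A (G k) := fun k => rfl
  have hB' : ∀ x x' : E3, |inner ℝ (A' x) (A' x') - lam ^ 2 * inner ℝ x x'| ≤ m * lam ^ 2 * ‖x‖ * ‖x'‖ := by
    intro x x'
    have h := hB (G x) (G x')
    rwa [G.inner_map_map, G.norm_map, G.norm_map] at h
  have ha0 : 0 ≤ a := (norm_nonneg _).trans ha
  have ha' : ‖(A' : E3 →L[ℝ] E3)‖ ≤ a := by
    refine ContinuousLinearMap.opNorm_le_bound _ ha0 fun x => ?_
    have h1 : ‖A (G x)‖ ≤ ‖(A : E3 →L[ℝ] E3)‖ * ‖G x‖ := (A : E3 →L[ℝ] E3).le_opNorm (G x)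
    have h2 : ‖(A : E3 →L[ℝ] E3)‖ * ‖G x‖ ≤ a * ‖x‖ := by
      rw [G.norm_map]
      exact mul_le_mul_of_nonneg_right ha (norm_nonneg _)
    exact h1.trans h2
  have hnear : ∀ i : ↥P, ∃ z ∈ Z, ‖z - (y + A' (patternStar P ν i))‖ ≤ δ₀ := by
    intro i
    obtain ⟨z, hz, hd⟩ := hstar i i.2
    refine ⟨z, hz, ?_⟩
    rwa [patternStar_apply, hA', LinearIsometryEquiv.map_smul]
  have h := voronoiCell_subset_image_shellCell (v := patternStar P ν) (A := A') (y := y) (Z := Z) hν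
    (norm_patternStar hP hν.le) hr hPc hm0 hB' ha' hσ hnear hout
  refine h.trans ?_
  rintro _ ⟨k, hk, rfl⟩
  exact ⟨k, hk, by simp only [affMap, sub_zero, hA']⟩

/-! ## §2 Nearness of the actual cell of a band site to its reference cell, from the rows -/

/-- ★ support (NEARNESS FROM THE STAR, one site): reference = placed close-packed sites (`s` Hägg, `0 < ν`, rigid
motion `(q, R)`), `r₀ = ν/√2`; actual atoms `windowAtomSet Ach ych yunc`. For a site `u` with position row
`dist (ych u) (placedSite u) ≤ û`, a world chart `A` with `‖A x − x‖ ≤ θ‖x‖`, conformal up to `m` at dilation `λ`,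
`‖A‖ ≤ a`, the STAR FIT at `δ₀` over the twelve reference neighbours (`barlowSiteForm s u u' = 12 ⇒ u' ∈ Ach ∧
dist (ych u') (ych u + A(placedSite u' − placedSite u)) ≤ δ₀`) and the outer inequality at slack `σ`: every point of the
actual cell of `ych u` is within `û + (θ(1+σ) + σ)·r₀` of `refCell u`.
[this file: «CellLattice» + §1 + «CollarBand» `nearness_of_rows`] -/
theorem near_of_star {μ : Type*} {s : ℤ → ℤ} (hs : IsHaggSeq s) {ν : ℝ} (hν : 0 < ν) (q : E3) (R : E3 ≃ₗᵢ[ℝ] E3)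
    (Ach : Set Idx) (ych : Idx → E3) (yunc : μ → E3) {r₀ : ℝ} (hr₀ : r₀ = ν / Real.sqrt 2) (u : Idx) (A : E3 ≃L[ℝ] E3)
    {û θ lam m a δ₀ σ : ℝ} (hθ0 : 0 ≤ θ) (hm0 : 0 ≤ m) (hσ : 0 ≤ σ)
    (hpos : dist (ych u) (placedSite s ν q R u) ≤ û) (hθ : ∀ x, ‖A x - x‖ ≤ θ * ‖x‖)
    (hB : ∀ x x' : E3, |inner ℝ (A x) (A x') - lam ^ 2 * inner ℝ x x'| ≤ m * lam ^ 2 * ‖x‖ * ‖x'‖)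
    (ha : ‖(A : E3 →L[ℝ] E3)‖ ≤ a)
    (hstar : ∀ u', barlowSiteForm s u u' = 12 →
      u' ∈ Ach ∧ dist (ych u') (ych u + A (placedSite s ν q R u' - placedSite s ν q R u)) ≤ δ₀)
    (hout : (1 + σ) * m * lam ^ 2 * ν ^ 2 / 2 + a * δ₀ * ((1 + σ) * r₀ + ν) + δ₀ ^ 2 / 2 <
      σ * (1 - m) * lam ^ 2 * ν ^ 2 / 2) :
    ∀ x ∈ voronoiCell (windowAtomSet Ach ych yunc) (ych u), ∃ x' ∈ refCell s ν q R u,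
      dist x x' ≤ û + (θ * (1 + σ) + σ) * r₀ := by
  obtain ⟨A₀, hK, hV⟩ := voronoiCell_placed_barlowStacking hs u.1 u.2.1 u.2.2 hν q R
  haveI : Nonempty ↥(bif decide (s (u.1 - 1) = s u.1) then fccKissingPattern else hcpKissingPattern) := nonempty_letterPattern _
  have hP : ∀ x ∈ (bif decide (s (u.1 - 1) = s u.1) then fccKissingPattern else hcpKissingPattern), ‖x‖ = 1 :=
    norm_eq_one_of_mem_letterPattern _
  -- the reference frame of the site: pattern frame → world
  set G : E3 ≃ₗᵢ[ℝ] E3 := A₀.trans R with hGdef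
  have hG : ∀ k, G k = R (A₀ k) := fun k => rfl
  have hcell : refCell s ν q R u = (fun k => placedSite s ν q R u + G k) '' idealCell (decide (s (u.1 - 1) = s u.1)) ν := by
    show voronoiCell (range (placedSite s ν q R)) (placedSite s ν q R u) = _
    rw [range_placedSite, placedSite_apply, hV]
    rfl
  -- the star fit in the form §1 wants
  have hstar' : ∀ p ∈ (bif decide (s (u.1 - 1) = s u.1) then fccKissingPattern else hcpKissingPattern),
      ∃ z ∈ windowAtomSet Ach ych yunc, ‖z - (ych u + A (ν • G p))‖ ≤ δ₀ := by
    intro p hp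
    have hpK : (2 : ℝ) • A₀ p ∈
        kissingShell (barlowStacking 2 layerSpacing s) (barlowPos 2 layerSpacing s u.1 u.2.1 u.2.2) := by
      rw [hK]
      exact ⟨p, hp, rfl⟩
    obtain ⟨k, i, j, hkij⟩ := mem_barlowStacking_iff.1 hpK.1
    have e : placedSite s ν q R (k, i, j) = q + (ν / 2) • R (barlowPos 2 layerSpacing s k i j) := rfl
    have hsite : placedSite s ν q R (k, i, j) - placedSite s ν q R u = ν • G p := by
      rw [e, ← hkij, placedSite_apply, map_add, smul_add, LinearIsometryEquiv.map_smul, smul_smul,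
        show ν / 2 * 2 = ν by ring, hG]
      abel
    have hd : dist (placedSite s ν q R u) (placedSite s ν q R (k, i, j)) = ν := by
      rw [dist_comm, dist_eq_norm, hsite, norm_smul, Real.norm_of_nonneg hν.le, G.norm_map, hP p hp, mul_one]
    obtain ⟨hA, hδ⟩ := hstar (k, i, j) ((dist_placedSite_eq_iff hν u (k, i, j)).1 hd)
    refine ⟨ych (k, i, j), Or.inl ⟨(k, i, j), hA, rfl⟩, ?_⟩
    rwa [dist_eq_norm, hsite] at hδ
  -- sandwich OUT (§1) at circumradius r₀
  have hr : r₀ ^ 2 ≤ ν ^ 2 / 2 := by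
    rw [hr₀]
    exact circumradius_sq ν
  have hPc : shellCell (patternStar (bif decide (s (u.1 - 1) = s u.1) then fccKissingPattern else hcpKissingPattern) ν) 1 ⊆
      closedBall 0 r₀ := by
    rw [shellCell_pattern hν 1, one_mul, hr₀]
    exact idealCell_subset_closedBall _ hν.le
  have hsub := voronoiCell_subset_image_of_star hP hν hr hPc G A hm0 hB ha hσ hstar' hout
  rw [shellCell_pattern hν (1 + σ)] at hsub
  -- nearness from rows («CollarBand»), pattern-frame chart `A ∘ G` against the frame `G`
  have h1σ : 0 < 1 + σ := by linarith
  have hK₀ : idealCell (decide (s (u.1 - 1) = s u.1)) ν ⊆ closedBall 0 r₀ := by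
    rw [hr₀]
    exact idealCell_subset_closedBall _ hν.le
  have hK₂ : voronoiCell (windowAtomSet Ach ych yunc) (ych u) ⊆
      (fun k => ych u + ((G.toContinuousLinearEquiv.trans A : E3 ≃L[ℝ] E3) : E3 →L[ℝ] E3) k) ''
        ((fun k => (1 + σ) • k) '' idealCell (decide (s (u.1 - 1) = s u.1)) ν) := by
    rw [image_smul, smul_idealCell h1σ]
    exact hsub
  have hθ' : ∀ k, ‖((G.toContinuousLinearEquiv.trans A : E3 ≃L[ℝ] E3) : E3 →L[ℝ] E3) k - G k‖ ≤ θ * ‖k‖ := by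
    intro k
    have h := hθ (G k)
    rw [G.norm_map] at h
    exact h
  have hmain := nearness_of_rows ((G.toContinuousLinearEquiv.trans A : E3 ≃L[ℝ] E3) : E3 →L[ℝ] E3) G hσ hθ0 hK₀ hK₂ hpos hθ'
  rw [hcell]
  exact hmain

/-! ## §3 The interface row from the rows -/

/-- ★★ THE INTERFACE ROW FROM THE ROWS: «CollarWindow» `interfaceRow_window` with its five window facts exported from
(R-reg) `hreg`, (R-unc) `hunc`, the per-band-site rows (R-pos) `hpos`, (R-chart) `hchart` / `hconf` / `hnorm`, (R-star) `hstar`,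
(R-num) `hnum`, and a booked width `w u ≥ ûs u + (θ u(1+σ) + σ)·r₀` on the band (`hwrow`); margins `2r₀ + 2û < m`,
`3r₀ + 2û < M`; the atlas part (`I`, `W`, `V`, `c`, `hI`, `hI'`, `hW0`, `hWd`, `hgA`, `hgB`, `hgP`, `hV`, `hc`, `hc0`) verbatim.
Conclusion `|∫_{collarActCore} g − ∫_{collarRefCore} g| ≤ Σ_{k∈I} c k · V k`. [this file] -/
theorem interfaceRow_rows {μ : Type*} [Finite μ] {s : ℤ → ℤ} (hs : IsHaggSeq s) {ν : ℝ} (hν : 0 < ν) (q : E3)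
    (R : E3 ≃ₗᵢ[ℝ] E3) {Ach : Set Idx} (hAfin : Ach.Finite) (hAne : Ach.Nonempty) (ych : Idx → E3) (yunc : μ → E3)
    (q₀ : E3) {r_c r₀ û m M : ℝ} (hr₀ : r₀ = ν / Real.sqrt 2) (hrc : 2 * r₀ < r_c) (hû : 0 ≤ û)
    (hm : 2 * r₀ + 2 * û < m) (hM : 3 * r₀ + 2 * û < M) (w : Idx → ℝ) (hw : ∀ u, 0 ≤ w u)
    -- (R-reg): charted atoms are `û`-registered; (R-unc): uncharted atoms are deep
    (hreg : ∀ u ∈ Ach, dist (ych u) (placedSite s ν q R u) ≤ û) (hunc : ∀ e, dist (yunc e) q₀ ≤ r_c - m + û)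
    -- the per-band-site rows
    (A : Idx → (E3 ≃L[ℝ] E3)) (ûs θ lam : Idx → ℝ) {mc a δ₀ σ : ℝ} (hmc : 0 ≤ mc) (hσ : 0 ≤ σ)
    (hpos : ∀ u, r_c - m < dist (placedSite s ν q R u) q₀ → dist (placedSite s ν q R u) q₀ < r_c + M →
      u ∈ Ach ∧ dist (ych u) (placedSite s ν q R u) ≤ ûs u)
    (hchart : ∀ u, r_c - m < dist (placedSite s ν q R u) q₀ → dist (placedSite s ν q R u) q₀ < r_c + M →
      0 ≤ θ u ∧ ∀ x, ‖A u x - x‖ ≤ θ u * ‖x‖)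
    (hconf : ∀ u, r_c - m < dist (placedSite s ν q R u) q₀ → dist (placedSite s ν q R u) q₀ < r_c + M →
      ∀ x x' : E3, |inner ℝ (A u x) (A u x') - lam u ^ 2 * inner ℝ x x'| ≤ mc * lam u ^ 2 * ‖x‖ * ‖x'‖)
    (hnorm : ∀ u, r_c - m < dist (placedSite s ν q R u) q₀ → dist (placedSite s ν q R u) q₀ < r_c + M →
      ‖(A u : E3 →L[ℝ] E3)‖ ≤ a)
    (hstar : ∀ u, r_c - m < dist (placedSite s ν q R u) q₀ → dist (placedSite s ν q R u) q₀ < r_c + M →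
      ∀ u', barlowSiteForm s u u' = 12 →
        u' ∈ Ach ∧ dist (ych u') (ych u + A u (placedSite s ν q R u' - placedSite s ν q R u)) ≤ δ₀)
    (hnum : ∀ u, r_c - m < dist (placedSite s ν q R u) q₀ → dist (placedSite s ν q R u) q₀ < r_c + M →
      (1 + σ) * mc * lam u ^ 2 * ν ^ 2 / 2 + a * δ₀ * ((1 + σ) * r₀ + ν) + δ₀ ^ 2 / 2 <
        σ * (1 - mc) * lam u ^ 2 * ν ^ 2 / 2)
    (hwrow : ∀ u, r_c - m < dist (placedSite s ν q R u) q₀ → dist (placedSite s ν q R u) q₀ < r_c + M →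
      ûs u + (θ u * (1 + σ) + σ) * r₀ ≤ w u)
    -- atlas: the piece list, widths, books, kernel bounds (verbatim «CollarWindow»)
    (I : Finset (Idx × Idx)) (W V c : Idx × Idx → ℝ) {g : E3 → ℝ}
    (hI : ∀ u ∈ collarCoreSites s ν q R q₀ r_c, ∀ u' ∉ collarCoreSites s ν q R q₀ r_c,
      barlowSiteForm s u u' ≤ 24 → (u, u') ∈ I)
    (hI' : ∀ k ∈ I, barlowSiteForm s k.1 k.2 = 12 ∨ barlowSiteForm s k.1 k.2 = 24) (hW0 : ∀ k ∈ I, 0 ≤ W k)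
    (hWd : ∀ u, ∀ k ∈ I, dist (placedSite s ν q R u) (midpoint ℝ (placedSite s ν q R k.1) (placedSite s ν q R k.2)) ≤
      r₀ + 2 * w u + pieceRadius s ν k → w u ≤ W k)
    (hgA : IntegrableOn g (collarRefCore s ν q R q₀ r_c)) (hgB : IntegrableOn g (collarActCore s ν q R Ach ych yunc q₀ r_c))
    (hgP : ∀ k ∈ I, IntegrableOn g (cthickening (W k) (refCell s ν q R k.1 ∩ refCell s ν q R k.2)))
    (hV : ∀ k ∈ I, (volume (cthickening (W k) (refCell s ν q R k.1 ∩ refCell s ν q R k.2))).toReal ≤ V k)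
    (hc : ∀ k ∈ I, ∀ x ∈ cthickening (W k) (refCell s ν q R k.1 ∩ refCell s ν q R k.2), |g x| ≤ c k)
    (hc0 : ∀ k ∈ I, 0 ≤ c k) :
    |(∫ x in collarActCore s ν q R Ach ych yunc q₀ r_c, g x) - ∫ x in collarRefCore s ν q R q₀ r_c, g x| ≤
      ∑ k ∈ I, c k * V k := by
  have hr₀pos : 0 < r₀ := by rw [hr₀]; positivity
  refine interfaceRow_window hs hν q R hAfin hAne ych yunc q₀ (û := û) (m' := m - û) (M' := M - û) hr₀ hrc (by linarith)
    (by linarith) (by linarith) (by linarith) w hw (fun u h1 h2 => ⟨(hpos u h1 h2).1, hreg u (hpos u h1 h2).1⟩) ?_ ?_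
    (fun e => by linarith [hunc e]) ?_ I W V c hI hI' hW0 hWd hgA hgB hgP hV hc hc0
  · -- (W-band) nearness: §2 with the booked width
    intro u h1 h2 x hx
    obtain ⟨x', hx', hd⟩ := near_of_star hs hν q R Ach ych yunc hr₀ u (A u) (hchart u h1 h2).1 hmc hσ (hpos u h1 h2).2
      (hchart u h1 h2).2 (hconf u h1 h2) (hnorm u h1 h2) (hstar u h1 h2) (hnum u h1 h2) x hx
    exact ⟨x', hx', hd.trans (hwrow u h1 h2)⟩
  · -- (W-core) deep charted atoms from registration
    intro u hu hd
    have h := dist_triangle (ych u) (placedSite s ν q R u) q₀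
    linarith [hreg u hu]
  · -- (W-far) far charted atoms from registration
    intro u hu hf
    have h := dist_triangle (placedSite s ν q R u) (ych u) q₀
    rw [dist_comm (placedSite s ν q R u) (ych u)] at h
    linarith [hreg u hu]

end

end Summit.AtomisticToContinuum.Crystallization.Theorems.OverbindingBudgetAffineFarFieldCollarNear
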